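import Mathlib
import HarnessLib
import Summits.HubbardSuperconductivity.HubbardSuperconductivity.Theorems.KLProgrammeKLRegimeVolumeLimitHartreeLimit

/-!
# Child 5 `KLRegimeVolumeLimitV7` (stmt-HubbardSuperconductivity-19665) — FRAME COVARIANCE of the volume-limit text:
# `FinalTwoLegVolLimit β U μ K' Mstar → FinalTwoLegVolLimit β U μ K Mstar` for any two frames (seat hubbard-kl-k3c5-p2)

Two instances of the frame reduction (`…VolumeLimitFrameReduction`: `βL² ĝ_K² Σ̂^K = N/D + βL² ĝ_K`, the right side's `N/D` frame-FREE) give,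
for every `U` at which the bare normalised partition function `D_{L,M}(U)` is non-zero, the FRAME COVARIANCE of the two-leg kernel:

  `Σ̂^K(k,σ;U) = (ĝ_{K'}(k)/ĝ_K(k))² · Σ̂^{K'}(k,σ;U) + (K − K')(p_k⃗) · ĝ_{K'}(k)/ĝ_K(k)`,

`ĝ_{K'}/ĝ_K = (−iω + e_K)/(−iω + e_{K'})` (`selfEnergy_fullActionCT_frame_covariance`).  The dressing is an explicit momentum-continuous function
read exactly on the grid, bounded by `1 + (‖K‖₀ + ‖K'‖₀) β/π`; hence the three clauses of the VL text TRANSFER between frames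
(`finalTwoLegVolLimit_frame_transfer`): given `D_{L,M}(U) ≠ 0` beyond the thresholds (t2's `stub_asm_partition` supplies it eventually in
`M` at every `L ≥ 3`), `FinalTwoLegVolLimit β U μ K' Mstar → FinalTwoLegVolLimit β U μ K Mstar`.  CONSEQUENCE for child 5
(`VolumeLimitP klPredsV7 FinalTwoLegVolLimit klWindowC` quantifies over EVERY admissible frame): the engine owes the termwise volume limit of the
two-leg kernel in ONE frame per `(β, U, μ)` — e.g. its own fixed-point frame — and every other frame follows by algebra.  Everything is proved;
no definition.
-/

noncomputable section

namespace Summit.HubbardSuperconductivity.HubbardSuperconductivity.Theorems.TwoPointAssembly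

set_option linter.dupNamespace false -- summit = problem name (single-conjunct summit), D-0017

open Finset Filter Topology Literature.MathematicalPhysics.QuantumLattice Literature.Probability.LatticeModels GrassmannAlgebra
open Summit.HubbardSuperconductivity.HubbardSuperconductivity.Theorems.KLRegimeSplit
open Summit.HubbardSuperconductivity.HubbardSuperconductivity.Theorems.KLProgrammeLegKernels

variable {L M : ℕ} [NeZero L]

/-! ## §1 Frame covariance of the two-leg kernel -/

omit [NeZero L] in
/-- The two renormalised bands differ by the frames: `e_{K'} = e_K + (K − K')(p)`. -/
theorem nambuXiCT_eq_add_frame_sub (μ : ℝ) (K K' : TrigPolyC4v) (q : TorusSite 2 L) :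
    nambuXiCT L μ K' q = nambuXiCT L μ K q + (K.eval (latticeMomentum L q) - K'.eval (latticeMomentum L q)) := by
  rw [nambuXiCT, nambuXiCT]; ring

/-- **Frame covariance**: for `β ≠ 0` and `D_{L,M}(U) ≠ 0`,
`Σ̂^K(k,σ;U) = (ĝ_{K'}/ĝ_K)² Σ̂^{K'}(k,σ;U) + (K − K')(p_k⃗) · ĝ_{K'}/ĝ_K`. -/
theorem selfEnergy_fullActionCT_frame_covariance {β : ℝ} (hβ : β ≠ 0) (U μ : ℝ) (K K' : TrigPolyC4v) (k : FreqMomentum L M)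
    (σ : Fin 2) (hD : effPartitionFn ℂ (hubbardCovariance L M β μ 0) (hubbardInteraction L M β U) ≠ 0) :
    selfEnergy L M β (fullActionCT L M β U μ K) k σ =
      (propCT L M β μ K' k / propCT L M β μ K k) ^ 2 * selfEnergy L M β (fullActionCT L M β U μ K') k σ +
        ((K.eval (latticeMomentum L k.2) - K'.eval (latticeMomentum L k.2) : ℝ) : ℂ) *
          (propCT L M β μ K' k / propCT L M β μ K k) := by
  have hβL : ((β * (L : ℝ) ^ 2 : ℝ) : ℂ) ≠ 0 := by
    have hL : (L : ℝ) ≠ 0 := by exact_mod_cast NeZero.ne L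
    exact_mod_cast mul_ne_zero hβ (pow_ne_zero 2 hL)
  have hDK := neg_I_mul_matsubaraFreq_add_ne_zero (M := M) hβ k.1 (nambuXiCT L μ K k.2)
  have hDK' := neg_I_mul_matsubaraFreq_add_ne_zero (M := M) hβ k.1 (nambuXiCT L μ K' k.2)
  rw [selfEnergy_fullActionCT_eq_bare_ratio hβ U μ K k σ hD, selfEnergy_fullActionCT_eq_bare_ratio hβ U μ K' k σ hD]
  set X : ℂ := gaussExpect ℂ (hubbardCovariance L M β μ 0)
      (gen ℂ (((k, σ), 0) : HubbardFieldIdx L M) * gen ℂ (((k, σ), 1) : HubbardFieldIdx L M) *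
        grassmannExp (-(hubbardInteraction L M β U))) /
    effPartitionFn ℂ (hubbardCovariance L M β μ 0) (hubbardInteraction L M β U) with hX
  have hrel : (nambuXiCT L μ K' k.2 : ℂ) =
      (nambuXiCT L μ K k.2 : ℂ) + ((K.eval (latticeMomentum L k.2) - K'.eval (latticeMomentum L k.2) : ℝ) : ℂ) := by
    rw [nambuXiCT_eq_add_frame_sub μ K K' k.2]; push_cast; ring
  rw [propCT, propCT, hrel]
  set δ : ℂ := ((K.eval (latticeMomentum L k.2) - K'.eval (latticeMomentum L k.2) : ℝ) : ℂ) with hδ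
  set D : ℂ := -Complex.I * (matsubaraFreq β M k.1 : ℂ) + (nambuXiCT L μ K k.2 : ℂ) with hDdef
  have hD' : -Complex.I * (matsubaraFreq β M k.1 : ℂ) + ((nambuXiCT L μ K k.2 : ℂ) + δ) = D + δ := by rw [hDdef]; ring
  rw [hD']
  have hD0 : D ≠ 0 := hDK
  have hD1 : D + δ ≠ 0 := by
    have := hDK'
    rwa [hrel, hD'] at this
  set c : ℂ := ((β * (L : ℝ) ^ 2 : ℝ) : ℂ) with hc
  field_simp
  ring

/-! ## §2 The dressing between two frames -/

omit [NeZero L] in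
/-- `‖(−iω + a)/(−iω + b)‖ ≤ 1 + |a − b|·β/π` for `|ω| ≥ π/β`. -/
theorem norm_shift_ratio_le {β : ℝ} (hβ : 0 < β) (ω : ℝ) (hω : Real.pi / β ≤ |ω|) (a b : ℝ) :
    ‖(-Complex.I * (ω : ℂ) + (a : ℂ)) / (-Complex.I * (ω : ℂ) + (b : ℂ))‖ ≤ 1 + |a - b| * (β / Real.pi) := by
  have hπβ : 0 < Real.pi / β := div_pos Real.pi_pos hβ
  have hω0 : 0 < |ω| := lt_of_lt_of_le hπβ hω
  set D : ℂ := -Complex.I * (ω : ℂ) + (b : ℂ) with hD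
  have hDim : D.im = -ω := by simp [hD]
  have hDnorm : |ω| ≤ ‖D‖ := by
    calc |ω| = |D.im| := by rw [hDim, abs_neg]
      _ ≤ ‖D‖ := Complex.abs_im_le_norm D
  have hDne : D ≠ 0 := fun h => by
    rw [h, norm_zero] at hDnorm
    linarith
  have hnum : (-Complex.I * (ω : ℂ) + (a : ℂ)) = D + ((a - b : ℝ) : ℂ) := by rw [hD]; push_cast; ring
  rw [hnum, add_div, div_self hDne]
  calc ‖(1 : ℂ) + ((a - b : ℝ) : ℂ) / D‖ ≤ ‖(1 : ℂ)‖ + ‖((a - b : ℝ) : ℂ) / D‖ := norm_add_le _ _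
    _ = 1 + |a - b| / ‖D‖ := by rw [norm_one, norm_div, Complex.norm_real, Real.norm_eq_abs]
    _ ≤ 1 + |a - b| * (β / Real.pi) := by
      gcongr 1 + ?_
      rw [div_le_iff₀ (lt_of_lt_of_le hω0 hDnorm)]
      calc |a - b| ≤ |a - b| * 1 := by rw [mul_one]
        _ = |a - b| * (β / Real.pi) * (Real.pi / β) := by field_simp
        _ ≤ |a - b| * (β / Real.pi) * ‖D‖ := mul_le_mul_of_nonneg_left (hω.trans hDnorm) (by positivity)

omit [NeZero L] in
/-- The frame dressing on the grid: `ĝ_{K'}/ĝ_K = (−iω + e_K)/(−iω + e_{K'})` (`β ≠ 0`). -/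
theorem propCT_div_propCT_eq {β : ℝ} (hβ : β ≠ 0) (μ : ℝ) (K K' : TrigPolyC4v) (k : FreqMomentum L M) :
    propCT L M β μ K' k / propCT L M β μ K k =
      (-Complex.I * (matsubaraFreq β M k.1 : ℂ) + (nambuXiCT L μ K k.2 : ℂ)) /
        (-Complex.I * (matsubaraFreq β M k.1 : ℂ) + (nambuXiCT L μ K' k.2 : ℂ)) := by
  have hDK := neg_I_mul_matsubaraFreq_add_ne_zero (M := M) hβ k.1 (nambuXiCT L μ K k.2)
  have hDK' := neg_I_mul_matsubaraFreq_add_ne_zero (M := M) hβ k.1 (nambuXiCT L μ K' k.2)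
  rw [propCT, propCT]
  field_simp

/-! ## §3 The volume-limit text transfers between frames -/

/-- **FRAME TRANSFER OF THE VL TEXT.**  If the bare normalised partition function is non-zero beyond the thresholds, then for `β > 0`
`FinalTwoLegVolLimit β U μ K' Mstar → FinalTwoLegVolLimit β U μ K Mstar` for ANY two frames `K`, `K'`. -/
theorem finalTwoLegVolLimit_frame_transfer {β : ℝ} (hβ : 0 < β) (U μ : ℝ) (K K' : TrigPolyC4v) (Mstar : ℕ → ℕ)
    (hD : ∃ LD : ℕ, ∀ (L : ℕ) [NeZero L], LD ≤ L → ∀ (M : ℕ) [NeZero M], Mstar L ≤ M →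
      effPartitionFn ℂ (hubbardCovariance L M β μ 0) (hubbardInteraction L M β U) ≠ 0)
    (h : FinalTwoLegVolLimit β U μ K' Mstar) : FinalTwoLegVolLimit β U μ K Mstar := by
  obtain ⟨LD, hLD⟩ := hD
  obtain ⟨sig', B', L₀', hcont', hbound', hlim'⟩ := h
  set ωn : ℤ → ℝ := fun n => Real.pi * (2 * (n : ℝ) + 1) / β with hωn
  -- the dressing `(−iω_n + e_K(p))/(−iω_n + e_{K'}(p))` and the frame difference `(K − K')(p)` as functions of `(n, p)`
  set eK : TrigPolyC4v → (Fin 2 → ℝ) → ℝ := fun J p => -2 * ∑ i, Real.cos (p i) - μ - J.eval p with heK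
  set dress : ℤ → (Fin 2 → ℝ) → ℂ := fun n p =>
    (-Complex.I * (ωn n : ℂ) + (eK K p : ℂ)) / (-Complex.I * (ωn n : ℂ) + (eK K' p : ℂ)) with hdress
  set δK : (Fin 2 → ℝ) → ℝ := fun p => K.eval p - K'.eval p with hδK
  set Bd : ℝ := 1 + (K.coeffNorm 0 + K'.coeffNorm 0) * (β / Real.pi) with hBd
  have hK0 : 0 ≤ K.coeffNorm 0 := TrigPolyC4v.coeffNorm_nonneg 0 K
  have hK0' : 0 ≤ K'.coeffNorm 0 := TrigPolyC4v.coeffNorm_nonneg 0 K'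
  have hBd1 : 1 ≤ Bd := le_add_of_nonneg_right (by positivity)
  have hBd0 : 0 ≤ Bd := le_trans zero_le_one hBd1
  have hωn_abs : ∀ n : ℤ, Real.pi / β ≤ |ωn n| := fun n => by
    rw [hωn]; dsimp only
    rw [abs_div, abs_of_pos hβ, abs_mul, abs_of_pos Real.pi_pos]
    exact div_le_div_of_nonneg_right (le_mul_of_one_le_right Real.pi_pos.le (one_le_abs_two_mul_add_one n)) hβ.le
  have hδ_le : ∀ p : Fin 2 → ℝ, |δK p| ≤ K.coeffNorm 0 + K'.coeffNorm 0 := fun p => by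
    rw [hδK]; dsimp only
    calc |K.eval p - K'.eval p| ≤ |K.eval p| + |K'.eval p| := abs_sub _ _
      _ ≤ K.coeffNorm 0 + K'.coeffNorm 0 := add_le_add (TrigPolyC4v.abs_eval_le_coeffNorm K p) (TrigPolyC4v.abs_eval_le_coeffNorm K' p)
  have heKdiff : ∀ p : Fin 2 → ℝ, eK K p - eK K' p = -(δK p) := fun p => by rw [heK, hδK]; dsimp only; ring
  -- bound of the dressing, anywhere
  have hdress_le : ∀ (ω : ℝ), Real.pi / β ≤ |ω| → ∀ p : Fin 2 → ℝ,
      ‖(-Complex.I * (ω : ℂ) + (eK K p : ℂ)) / (-Complex.I * (ω : ℂ) + (eK K' p : ℂ))‖ ≤ Bd := by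
    intro ω hω p
    refine (norm_shift_ratio_le hβ ω hω _ _).trans ?_
    rw [heKdiff, abs_neg, hBd]
    gcongr
    exact hδ_le p
  -- the band on the grid
  have heK_grid : ∀ (J : TrigPolyC4v) (L : ℕ) [NeZero L] (q : TorusSite 2 L), (nambuXiCT L μ J q : ℝ) = eK J (latticeMomentum L q) := by
    intro J L _ q; rw [heK]; dsimp only; rw [nambuXiCT, torusBand]
  refine ⟨fun n p σ => dress n p ^ 2 * sig' n p σ + (δK p : ℂ) * dress n p,
    Bd ^ 2 * B' + (K.coeffNorm 0 + K'.coeffNorm 0) * Bd, max L₀' LD, ?_, ?_, ?_⟩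
  · -- continuity
    intro n σ
    have hden : ∀ p : Fin 2 → ℝ, -Complex.I * (ωn n : ℂ) + (eK K' p : ℂ) ≠ 0 := by
      intro p hp
      have := congrArg Complex.im hp
      simp at this
      have h' := hωn_abs n
      have hπβ : 0 < Real.pi / β := div_pos Real.pi_pos hβ
      rw [this, abs_zero] at h'
      linarith
    have heKc : ∀ J : TrigPolyC4v, Continuous (eK J) := fun J => by
      rw [heK]
      exact ((continuous_const.mul (continuous_finsetSum _ fun i _ =>
        Real.continuous_cos.comp (continuous_apply i))).sub continuous_const).sub (TrigPolyC4v.continuous_eval J)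
    have hd : Continuous (dress n) := by
      refine Continuous.div ?_ ?_ hden
      · exact continuous_const.add (Complex.continuous_ofReal.comp (heKc K))
      · exact continuous_const.add (Complex.continuous_ofReal.comp (heKc K'))
    have hδc : Continuous fun p => (δK p : ℂ) :=
      Complex.continuous_ofReal.comp ((TrigPolyC4v.continuous_eval K).sub (TrigPolyC4v.continuous_eval K'))
    exact ((hd.pow 2).mul (hcont' n σ)).add (hδc.mul hd)
  · -- uniform bound
    intro L _ hL M _ hM k σ
    have hLD' : LD ≤ L := le_trans (le_max_right _ _) hL
    have hL0 : L₀' ≤ L := le_trans (le_max_left _ _) hL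
    have hDne := hLD L hLD' M hM
    have hcov : klSelfEnergy L M β U μ K klE0 (nScales β + 1) k σ =
        (propCT L M β μ K' k / propCT L M β μ K k) ^ 2 * klSelfEnergy L M β U μ K' klE0 (nScales β + 1) k σ +
          ((K.eval (latticeMomentum L k.2) - K'.eval (latticeMomentum L k.2) : ℝ) : ℂ) *
            (propCT L M β μ K' k / propCT L M β μ K k) := by
      rw [klSelfEnergy, klSelfEnergy, klEffectiveAction_nScales_succ L M hβ, klEffectiveAction_nScales_succ L M hβ, ← fullActionCT,
        ← fullActionCT]
      exact selfEnergy_fullActionCT_frame_covariance hβ.ne' U μ K K' k σ hDne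
    have hdr : ‖propCT L M β μ K' k / propCT L M β μ K k‖ ≤ Bd := by
      rw [propCT_div_propCT_eq hβ.ne', heK_grid K L k.2, heK_grid K' L k.2]
      exact hdress_le _ (pi_div_le_abs_matsubaraFreq hβ k.1) _
    have hS' := hbound' L hL0 M hM k σ
    have hB'0 : 0 ≤ B' := le_trans (norm_nonneg _) hS'
    rw [hcov]
    calc ‖(propCT L M β μ K' k / propCT L M β μ K k) ^ 2 * klSelfEnergy L M β U μ K' klE0 (nScales β + 1) k σ +
            ((K.eval (latticeMomentum L k.2) - K'.eval (latticeMomentum L k.2) : ℝ) : ℂ) *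
              (propCT L M β μ K' k / propCT L M β μ K k)‖
        ≤ ‖propCT L M β μ K' k / propCT L M β μ K k‖ ^ 2 * ‖klSelfEnergy L M β U μ K' klE0 (nScales β + 1) k σ‖ +
            |K.eval (latticeMomentum L k.2) - K'.eval (latticeMomentum L k.2)| * ‖propCT L M β μ K' k / propCT L M β μ K k‖ := by
          refine (norm_add_le _ _).trans (le_of_eq ?_)
          rw [norm_mul, norm_pow, norm_mul, Complex.norm_real, Real.norm_eq_abs]
      _ ≤ Bd ^ 2 * B' + (K.coeffNorm 0 + K'.coeffNorm 0) * Bd := by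
          gcongr
          exact hδ_le _
  · -- grid convergence
    intro n σ ε hε
    have hε' : 0 < ε / Bd ^ 2 := by positivity
    obtain ⟨L₁', hL₁'⟩ := hlim' n σ (ε / Bd ^ 2) hε'
    refine ⟨max L₁' LD, fun L _ hLge => ?_⟩
    have hL1 : L₁' ≤ L := le_trans (le_max_left _ _) hLge
    have hLD' : LD ≤ L := le_trans (le_max_right _ _) hLge
    obtain ⟨M₁', hM₁'⟩ := hL₁' L hL1
    refine ⟨max M₁' (Mstar L), fun M _ hMge ω hω q => ?_⟩
    have hM1 : M₁' ≤ M := le_trans (le_max_left _ _) hMge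
    have hMs : Mstar L ≤ M := le_trans (le_max_right _ _) hMge
    have hDne := hLD L hLD' M hMs
    have hcov : klSelfEnergy L M β U μ K klE0 (nScales β + 1) (ω, q) σ =
        (propCT L M β μ K' (ω, q) / propCT L M β μ K (ω, q)) ^ 2 * klSelfEnergy L M β U μ K' klE0 (nScales β + 1) (ω, q) σ +
          ((K.eval (latticeMomentum L q) - K'.eval (latticeMomentum L q) : ℝ) : ℂ) *
            (propCT L M β μ K' (ω, q) / propCT L M β μ K (ω, q)) := by
      rw [klSelfEnergy, klSelfEnergy, klEffectiveAction_nScales_succ L M hβ, klEffectiveAction_nScales_succ L M hβ, ← fullActionCT,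
        ← fullActionCT]
      exact selfEnergy_fullActionCT_frame_covariance hβ.ne' U μ K K' (ω, q) σ hDne
    -- on the grid the dressing IS `dress n (p_q)` and the frame difference IS `δK (p_q)`
    have hdr : propCT L M β μ K' (ω, q) / propCT L M β μ K (ω, q) = dress n (latticeMomentum L q) := by
      rw [propCT_div_propCT_eq hβ.ne', hdress]
      dsimp only
      rw [heK_grid K L q, heK_grid K' L q, matsubaraFreq_of_matsubaraInt_eq β hω]
    have hdb : ‖dress n (latticeMomentum L q)‖ ≤ Bd := by
      rw [hdress]
      exact hdress_le _ (hωn_abs n) _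
    have hgrid := hM₁' M hM1 ω hω q
    rw [hcov, hdr]
    calc ‖dress n (latticeMomentum L q) ^ 2 * klSelfEnergy L M β U μ K' klE0 (nScales β + 1) (ω, q) σ +
            ((K.eval (latticeMomentum L q) - K'.eval (latticeMomentum L q) : ℝ) : ℂ) * dress n (latticeMomentum L q) -
          (dress n (latticeMomentum L q) ^ 2 * sig' n (latticeMomentum L q) σ +
            (δK (latticeMomentum L q) : ℂ) * dress n (latticeMomentum L q))‖
        = ‖dress n (latticeMomentum L q)‖ ^ 2 *
            ‖klSelfEnergy L M β U μ K' klE0 (nScales β + 1) (ω, q) σ - sig' n (latticeMomentum L q) σ‖ := by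
          rw [hδK]
          dsimp only
          rw [show ∀ a s t d : ℂ, a ^ 2 * s + d * a - (a ^ 2 * t + d * a) = a ^ 2 * (s - t) from fun a s t d => by ring,
            norm_mul, norm_pow]
      _ ≤ Bd ^ 2 * (ε / Bd ^ 2) := by gcongr
      _ = ε := by field_simp

end Summit.HubbardSuperconductivity.HubbardSuperconductivity.Theorems.TwoPointAssembly

end
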